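import Mathlib
import Summits.Ventures.PercRepro2.ThreeTypedAbstract

/-!
# Three typed edges, shards 4/11 (blind cell PercRepro2, night-3, 2026-08-24)

`decide +kernel` of the shards `shard a1 … a5 = true` of `allOk3` for the canonical prefixes listed
below (16 shards, 56078 labellings of the eleven points in this file).
-/

set_option Elab.async false

namespace Summit.Ventures.PercRepro2

open UnionCluster

namespace CovForm

namespace TwoTyped

open OneTyped

set_option maxHeartbeats 0 in
/-- Shard `(1, 1, 3, 4, 3)` (4736 labellings). -/
theorem sh_1_1_3_4_3 : shard 1 1 3 4 3 = true := by
  decide +kernel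

set_option maxHeartbeats 0 in
/-- Shard `(1, 1, 3, 4, 4)` (4736 labellings). -/
theorem sh_1_1_3_4_4 : shard 1 1 3 4 4 = true := by
  decide +kernel

set_option maxHeartbeats 0 in
/-- Shard `(1, 1, 3, 4, 5)` (10427 labellings). -/
theorem sh_1_1_3_4_5 : shard 1 1 3 4 5 = true := by
  decide +kernel

set_option maxHeartbeats 0 in
/-- Shard `(1, 2, 0, 0, 0)` (1915 labellings). -/
theorem sh_1_2_0_0_0 : shard 1 2 0 0 0 = true := by
  decide +kernel

set_option maxHeartbeats 0 in
/-- Shard `(1, 2, 0, 0, 1)` (1915 labellings). -/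
theorem sh_1_2_0_0_1 : shard 1 2 0 0 1 = true := by
  decide +kernel

set_option maxHeartbeats 0 in
/-- Shard `(1, 2, 0, 0, 2)` (1915 labellings). -/
theorem sh_1_2_0_0_2 : shard 1 2 0 0 2 = true := by
  decide +kernel

set_option maxHeartbeats 0 in
/-- Shard `(1, 2, 0, 0, 5)` (4736 labellings). -/
theorem sh_1_2_0_0_5 : shard 1 2 0 0 5 = true := by
  decide +kernel

set_option maxHeartbeats 0 in
/-- Shard `(1, 2, 0, 1, 0)` (1915 labellings). -/
theorem sh_1_2_0_1_0 : shard 1 2 0 1 0 = true := by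
  decide +kernel

set_option maxHeartbeats 0 in
/-- Shard `(1, 2, 0, 1, 1)` (1915 labellings). -/
theorem sh_1_2_0_1_1 : shard 1 2 0 1 1 = true := by
  decide +kernel

set_option maxHeartbeats 0 in
/-- Shard `(1, 2, 0, 1, 2)` (1915 labellings). -/
theorem sh_1_2_0_1_2 : shard 1 2 0 1 2 = true := by
  decide +kernel

set_option maxHeartbeats 0 in
/-- Shard `(1, 2, 0, 1, 5)` (4736 labellings). -/
theorem sh_1_2_0_1_5 : shard 1 2 0 1 5 = true := by
  decide +kernel

set_option maxHeartbeats 0 in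
/-- Shard `(1, 2, 0, 2, 0)` (1915 labellings). -/
theorem sh_1_2_0_2_0 : shard 1 2 0 2 0 = true := by
  decide +kernel

set_option maxHeartbeats 0 in
/-- Shard `(1, 2, 0, 2, 1)` (1915 labellings). -/
theorem sh_1_2_0_2_1 : shard 1 2 0 2 1 = true := by
  decide +kernel

set_option maxHeartbeats 0 in
/-- Shard `(1, 2, 0, 2, 2)` (1915 labellings). -/
theorem sh_1_2_0_2_2 : shard 1 2 0 2 2 = true := by
  decide +kernel

set_option maxHeartbeats 0 in
/-- Shard `(1, 2, 0, 2, 5)` (4736 labellings). -/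
theorem sh_1_2_0_2_5 : shard 1 2 0 2 5 = true := by
  decide +kernel

set_option maxHeartbeats 0 in
/-- Shard `(1, 2, 0, 4, 0)` (4736 labellings). -/
theorem sh_1_2_0_4_0 : shard 1 2 0 4 0 = true := by
  decide +kernel

end TwoTyped

end CovForm

end Summit.Ventures.PercRepro2
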